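import Summits.HodgeConjecture.CorCM.MumfordTateRankThree
import Literature.AlgebraicGeometry.Motives.MumfordTateInvariantsBaseChange
import HarnessLib

/-!
# A complex abelian variety is of CM type iff its Mumford–Tate Lie algebra is abelian, iff it consists of Hodge
# endomorphisms, iff the rational commutant of its endomorphisms on `H¹` is commutative (Deligne I 5.1, Lie form)

COR-CM (cell `pub-hodgecm2`, seat `b27` gen 29, count-neutral lane MT-RANK-THREE, file 3; theorems only, no definition,
no named fact; UNCONDITIONAL).  `CorCM/MumfordTateRankThree` (§1) proved «`𝔪𝔱(H¹(X)) ⊆ End_Hdg(H¹(X))` ⟹ `X` of CM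
type»; this file adds the converses and packages the Lie-algebra form of Deligne's definition/criterion «an abelian
variety is of CM-type if its Mumford–Tate group is commutative» (LNM 900, I §5; in the tree at GROUP level on
`ℂ`-points: `HodgeTheory.isOfCMType_iff_mumfordTateGroup_comm`, `isOfCMType_iff_hodgeGroup_comm`, and for the
complex commutant `C(A) ⊗ ℂ`: `isOfCMType_iff_centralizerAlgebra_comm`) for the tree's RATIONAL Mumford–Tate Lie
algebra `𝔪𝔱 = (BettiUniverse.hodge _ hX 1).mumfordTateLieAlgebra ⊆ End_ℚ H¹(X(ℂ); ℚ)` (whose dimension is the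
`mtRank` of the MT-rank ladder files):

* §1 `commute_of_forall_commute_bettiMap_of_isOfCMType` — **for `X` of CM type the commutant of the pull-backs
  `u^*`, `u ∈ End X`, in `End_ℚ H¹(X(ℂ); ℚ)` is commutative** (Milne 1999 Rem. 1.10 «`C₀(A) ⊗ Q → C(A)` is an
  isomorphism», rational form: transport along `β : H¹(X(ℂ); ℚ) ⊗ ℂ ≃ H¹(X(ℂ); ℂ)` into the tree's `C(A) ⊗ ℂ`,
  `centralizerAlgebra_comm_of_isOfCMType`, and descent by `one_tmul_injective`); with the tree's lever
  `isOfCMType_of_centralizer_bettiCohomology_comm` this is the equivalence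
  `isOfCMType_iff_forall_commute_bettiMap_comm`.
* §2 `commute_of_mem_mumfordTateLieAlgebra_of_isOfCMType` — **for `X` of CM type, `𝔪𝔱(H¹(X))` is abelian** (`𝔪𝔱`
  commutes with the Hodge endomorphisms `u^*`, Deligne I 3.4, hence lies in the rational commutant of §1);
  `mumfordTateLieAlgebra_le_endAlg_of_isOfCMType` — **and consists of Hodge endomorphisms** (an element of an abelian
  `𝔪𝔱` commutes with `Lie Hdg ⊆ 𝔪𝔱`, whose commutant is `End_Hdg`: `HodgeStructure.mumfordTateLieAlgebra_le_endAlg_of_comm`).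
* §3 the equivalences, for EVERY complex abelian variety `X`:
  **`isOfCMType_iff_mumfordTateLieAlgebra_comm`** («CM ⟺ `𝔪𝔱(H¹(X))` abelian», Deligne I §5 / Moonen–Zarhin §2 in Lie
  form), **`isOfCMType_iff_mumfordTateLieAlgebra_le_endAlg`** («CM ⟺ `𝔪𝔱(H¹(X)) ⊆ End_Hdg(H¹(X))`»,
  Green–Griffiths–Kerr Ch. V «`M(ℚ) ⊆ End(V, φ)`» in Lie form); the abstract equivalence `𝔪𝔱 ⊆ End_Hdg ⟺ 𝔪𝔱`
  abelian is `HodgeStructure.mumfordTateLieAlgebra_le_endAlg_iff_comm` (`Motives/MumfordTateRankThree` §7).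

## References

* [Deligne1982HodgeCycles] P. Deligne, *Hodge cycles on abelian varieties*, LNM 900 (1982), I Prop. 3.4; §5 and
  Prop. 5.1 («An abelian variety A is said to be of CM-type if its Mumford–Tate group is commutative … E is the
  commutant of G in End(H₁(A,ℚ))»).
* [Milne1999] J. S. Milne, *Lefschetz motives and the Tate conjecture*, Compositio Math. 117 (1999),
  §1 Rem. 1.10 (p. 53).
* [GreenGriffithsKerr2012] M. Green, P. Griffiths, M. Kerr, *Mumford–Tate Groups and Domains* (2012), Ch. V p. 20,
  (V.2)–(V.3).
* [MoonenZarhin1999LowDim] B. Moonen, Yu. Zarhin, *Hodge classes on abelian varieties of low dimension*, Math. Ann. 315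
  (1999), §2 («`X` is of CM type iff `Hg(X)` is commutative»).
* [DeligneMilne1982Tannakian] P. Deligne, J. S. Milne, *Tannakian Categories*, LNM 900 (1982), §6 Thm. 6.20 (Riemann).
-/

noncomputable section

open scoped TensorProduct
open CategoryTheory CategoryTheory.Limits NumberField Module
open scoped BigOperators

namespace Summit.HodgeConjecture.CorCM

open Literature.AlgebraicGeometry.Motives
open Literature.AlgebraicGeometry.Motives.AbelianVariety
open Literature.AlgebraicGeometry.Motives.HodgeStructure
open Literature.AlgebraicGeometry.HodgeTheory
open Literature.AlgebraicGeometry.ComplexMultiplication (IsCMTypeRealisation)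
open Literature.AlgebraicGeometry.Milne1999 (IsOfCMType centralizerAlgebra mem_centralizerAlgebra_iff)
open Literature.AlgebraicGeometry.VanGeemen1994 (pullbackOne)

/-! ## §1 For `X` of CM type the rational commutant of the `u^*` is commutative -/

section Commutant

variable {X : AbelianVariety ℂ}

/-- **Milne 1999 Rem. 1.10 over `ℚ`: for `X` of CM type, any two endomorphisms of `H¹(X(ℂ); ℚ)` commuting with all
pull-backs `u^*`, `u ∈ End X`, commute with each other.**  Transported along `β : H¹(X(ℂ); ℚ) ⊗ ℂ ≃ H¹(X(ℂ); ℂ)`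
(`ofRatClassBaseChangeEquiv`, `u^* ∘ β = β ∘ (u^*_ℚ ⊗ 1)`), their complexifications lie in the tree's `C(A) ⊗ ℂ`
(`Milne1999.centralizerAlgebra`), which is commutative for `X` of CM type (`centralizerAlgebra_comm_of_isOfCMType`);
descend by `one_tmul_injective`. [cite: Milne1999, §1 Remark 1.10 (p. 53)]
[cite: Deligne1982HodgeCycles, I §5 Prop. 5.1 (proof)] -/
theorem commute_of_forall_commute_bettiMap_of_isOfCMType (hcm : IsOfCMType X)
    {x y : Module.End ℚ (bettiCohomology X.X 1)}
    (hx : ∀ u : X ⟶ X, (bettiCohomology.map u.hom.hom.hom 1).hom * x = x * (bettiCohomology.map u.hom.hom.hom 1).hom)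
    (hy : ∀ u : X ⟶ X, (bettiCohomology.map u.hom.hom.hom 1).hom * y = y * (bettiCohomology.map u.hom.hom.hom 1).hom) :
    x * y = y * x := by
  have hX := AbelianVariety.isSmoothProjective_holds (A := X)
  let β : ℂ ⊗[ℚ] bettiCohomology X.X 1 ≃ₗ[ℂ] complexBetti X.X 1 := ofRatClassBaseChangeEquiv hX 1
  have hβ : ∀ (φ : X ⟶ X) (t : ℂ ⊗[ℚ] bettiCohomology X.X 1),
      pullbackOne X φ (β t) = β (((bettiCohomology.map φ.hom.hom.hom 1).hom.baseChange ℂ) t) :=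
    fun φ t => complexBetti_map_ofRatClassBaseChangeEquiv hX hX φ.hom.hom.hom t
  -- transport of a rational endomorphism to `H¹(X(ℂ); ℂ)`
  let tr : Module.End ℚ (bettiCohomology X.X 1) → Module.End ℂ (complexBetti X.X 1) :=
    fun f => β.toLinearMap ∘ₗ f.baseChange ℂ ∘ₗ β.symm.toLinearMap
  have htr : ∀ (f : Module.End ℚ (bettiCohomology X.X 1)) (t : ℂ ⊗[ℚ] bettiCohomology X.X 1),
      tr f (β t) = β (f.baseChange ℂ t) := fun f t => by
    simp only [tr, LinearMap.coe_comp, LinearEquiv.coe_coe, Function.comp_apply, LinearEquiv.symm_apply_apply]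
  have htr_mul : ∀ f g : Module.End ℚ (bettiCohomology X.X 1), tr (f * g) = tr f * tr g := by
    intro f g
    refine LinearMap.ext fun w => ?_
    obtain ⟨t, rfl⟩ := β.surjective w
    rw [Module.End.mul_apply, htr, htr, htr, LinearMap.baseChange_mul, Module.End.mul_apply]
  -- the transports lie in `C(A) ⊗ ℂ`
  have hmem : ∀ f : Module.End ℚ (bettiCohomology X.X 1),
      (∀ u : X ⟶ X, (bettiCohomology.map u.hom.hom.hom 1).hom * f = f * (bettiCohomology.map u.hom.hom.hom 1).hom) →
      tr f ∈ centralizerAlgebra X := by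
    intro f hf
    rw [mem_centralizerAlgebra_iff]
    intro φ
    refine LinearMap.ext fun w => ?_
    obtain ⟨t, rfl⟩ := β.surjective w
    rw [Module.End.mul_apply, Module.End.mul_apply, htr, hβ, hβ, htr, ← Module.End.mul_apply,
      ← LinearMap.baseChange_mul, hf φ, LinearMap.baseChange_mul, Module.End.mul_apply]
  have key : tr x * tr y = tr y * tr x :=
    centralizerAlgebra_comm_of_isOfCMType hcm _ (hmem x hx) _ (hmem y hy)
  rw [← htr_mul, ← htr_mul] at key
  -- descend to `ℚ`
  refine LinearMap.ext fun v => one_tmul_injective ?_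
  have h := LinearMap.congr_fun key (β ((1 : ℂ) ⊗ₜ[ℚ] v))
  rw [htr, htr, LinearMap.baseChange_tmul, LinearMap.baseChange_tmul] at h
  exact β.injective h

/-- **`X` is of CM type iff the commutant of `{u^* | u ∈ End X}` in `End_ℚ H¹(X(ℂ); ℚ)` is commutative** (Milne 1999
Rem. 1.10 «has many endomorphisms» ⟺ CM, rational form; `⟸` is the tree's lever
`isOfCMType_of_centralizer_bettiCohomology_comm`). [cite: Milne1999, §1 Remark 1.10 (p. 53)]
[cite: Deligne1982HodgeCycles, I §5 Prop. 5.1] -/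
theorem isOfCMType_iff_forall_commute_bettiMap_comm (X : AbelianVariety ℂ) :
    IsOfCMType X ↔ ∀ x y : Module.End ℚ (bettiCohomology X.X 1),
      (∀ u : X ⟶ X, (bettiCohomology.map u.hom.hom.hom 1).hom * x = x * (bettiCohomology.map u.hom.hom.hom 1).hom) →
      (∀ u : X ⟶ X, (bettiCohomology.map u.hom.hom.hom 1).hom * y = y * (bettiCohomology.map u.hom.hom.hom 1).hom) →
        x * y = y * x :=
  ⟨fun hcm _ _ hx hy => commute_of_forall_commute_bettiMap_of_isOfCMType hcm hx hy,
    fun h => isOfCMType_of_centralizer_bettiCohomology_comm Set.univ fun x y hx hy =>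
      h x y (fun u => hx u (Set.mem_univ u)) (fun u => hy u (Set.mem_univ u))⟩

end Commutant

/-! ## §2 For `X` of CM type, `𝔪𝔱(H¹(X))` is abelian and consists of Hodge endomorphisms -/

section OfCMType

variable [HodgeTensorFacts.{0, 0}] {X : AbelianVariety ℂ} {n : ℕ}

omit [HodgeTensorFacts.{0, 0}] in
/-- Pull-backs `u^*` along endomorphisms are Hodge endomorphisms of `H¹(X(ℂ); ℚ)` (`BettiUniverse.pull_hodge`).
[cite: VoisinHodgeI2002, §7.3.2] -/
theorem bettiMap_mem_endAlg (hX : IsSmoothProjective n X.X) (u : X ⟶ X) :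
    (bettiCohomology.map u.hom.hom.hom 1).hom ∈ (BettiUniverse.hodge exists_isReal_hodgeModel_holds hX 1).endAlg :=
  fun p => BettiUniverse.pull_hodge exists_isReal_hodgeModel_holds hodgePQ_independent_of_hodgeModel_holds hX hX
    u.hom.hom.hom 1 p

/-- **`𝔪𝔱(H¹(X))` commutes with every pull-back `u^*`** (`u^*` is a Hodge endomorphism and `𝔪𝔱` commutes with those,
Deligne I 3.4). [cite: Deligne1982HodgeCycles, I Prop. 3.4] -/
theorem bettiMap_mul_eq_mul_of_mem_mumfordTateLieAlgebra (hX : IsSmoothProjective n X.X)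
    {x : Module.End ℚ (bettiCohomology X.X 1)}
    (hx : haveI := BettiUniverse.finite hX 1
      x ∈ (BettiUniverse.hodge exists_isReal_hodgeModel_holds hX 1).mumfordTateLieAlgebra) (u : X ⟶ X) :
    (bettiCohomology.map u.hom.hom.hom 1).hom * x = x * (bettiCohomology.map u.hom.hom.hom 1).hom := by
  haveI := BettiUniverse.finite hX 1
  exact (commute_of_mem_mumfordTateLieAlgebra _ hx (bettiMap_mem_endAlg hX u)).symm

/-- **For `X` of CM type, `𝔪𝔱(H¹(X))` is ABELIAN** — the Lie-algebra form of «the Mumford–Tate group of a CM abelian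
variety is a torus» (Deligne I §5): two elements of `𝔪𝔱` commute with all `u^*`, hence with each other (§1).
[cite: Deligne1982HodgeCycles, I §5 Prop. 5.1] [cite: MoonenZarhin1999LowDim, §2] -/
theorem commute_of_mem_mumfordTateLieAlgebra_of_isOfCMType (hX : IsSmoothProjective n X.X) (hcm : IsOfCMType X)
    {x y : Module.End ℚ (bettiCohomology X.X 1)}
    (hx : haveI := BettiUniverse.finite hX 1
      x ∈ (BettiUniverse.hodge exists_isReal_hodgeModel_holds hX 1).mumfordTateLieAlgebra)
    (hy : haveI := BettiUniverse.finite hX 1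
      y ∈ (BettiUniverse.hodge exists_isReal_hodgeModel_holds hX 1).mumfordTateLieAlgebra) :
    x * y = y * x :=
  commute_of_forall_commute_bettiMap_of_isOfCMType hcm (bettiMap_mul_eq_mul_of_mem_mumfordTateLieAlgebra hX hx)
    (bettiMap_mul_eq_mul_of_mem_mumfordTateLieAlgebra hX hy)

/-- **For `X` of CM type, `𝔪𝔱(H¹(X)) ⊆ End_Hdg(H¹(X))`**: the Mumford–Tate Lie algebra consists of Hodge
endomorphisms («`M(ℚ) ⊆ End(V, φ)`», Green–Griffiths–Kerr Ch. V, in Lie form). [cite: GreenGriffithsKerr2012, Ch. V p. 20]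
[cite: Deligne1982HodgeCycles, I §5 Prop. 5.1] -/
theorem mumfordTateLieAlgebra_le_endAlg_of_isOfCMType (hX : IsSmoothProjective n X.X) (hcm : IsOfCMType X) :
    haveI := BettiUniverse.finite hX 1
    (BettiUniverse.hodge exists_isReal_hodgeModel_holds hX 1).mumfordTateLieAlgebra ≤
      Subalgebra.toSubmodule (BettiUniverse.hodge exists_isReal_hodgeModel_holds hX 1).endAlg := by
  haveI := BettiUniverse.finite hX 1
  exact mumfordTateLieAlgebra_le_endAlg_of_comm _
    fun x hx y hy => commute_of_mem_mumfordTateLieAlgebra_of_isOfCMType hX hcm hx hy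

end OfCMType

/-! ## §3 The equivalences -/

section Iff

variable [HodgeTensorFacts.{0, 0}] {X : AbelianVariety ℂ} {n : ℕ}

/-- **A complex abelian variety is of CM type iff its Mumford–Tate Lie algebra consists of Hodge endomorphisms**
(`CorCM/MumfordTateRankThree` §1 for `⟸`). [cite: GreenGriffithsKerr2012, Ch. V p. 20 and (V.2)–(V.3)]
[cite: Deligne1982HodgeCycles, I §5 Prop. 5.1] -/
theorem isOfCMType_iff_mumfordTateLieAlgebra_le_endAlg (hX : IsSmoothProjective n X.X) :
    haveI := BettiUniverse.finite hX 1
    IsOfCMType X ↔ (BettiUniverse.hodge exists_isReal_hodgeModel_holds hX 1).mumfordTateLieAlgebra ≤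
      Subalgebra.toSubmodule (BettiUniverse.hodge exists_isReal_hodgeModel_holds hX 1).endAlg :=
  ⟨mumfordTateLieAlgebra_le_endAlg_of_isOfCMType hX, isOfCMType_of_mumfordTateLieAlgebra_le_endAlg hX⟩

/-- **A complex abelian variety is of CM type iff its Mumford–Tate Lie algebra is abelian** — Deligne's definition
«A is of CM-type if its Mumford–Tate group is commutative» (LNM 900 I §5) / Moonen–Zarhin §2, for the tree's rational
`𝔪𝔱 ⊆ End_ℚ H¹(X(ℂ); ℚ)` and the tree's `IsOfCMType` (a commutative semisimple `ℚ`-subalgebra of `End⁰(X)` of degree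
`2 dim X`). [cite: Deligne1982HodgeCycles, I §5 Prop. 5.1] [cite: MoonenZarhin1999LowDim, §2] -/
theorem isOfCMType_iff_mumfordTateLieAlgebra_comm (hX : IsSmoothProjective n X.X) :
    haveI := BettiUniverse.finite hX 1
    IsOfCMType X ↔ ∀ x ∈ (BettiUniverse.hodge exists_isReal_hodgeModel_holds hX 1).mumfordTateLieAlgebra,
      ∀ y ∈ (BettiUniverse.hodge exists_isReal_hodgeModel_holds hX 1).mumfordTateLieAlgebra, x * y = y * x := by
  haveI := BettiUniverse.finite hX 1
  rw [isOfCMType_iff_mumfordTateLieAlgebra_le_endAlg hX, mumfordTateLieAlgebra_le_endAlg_iff_comm]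

end Iff

/-! ## §4 The bottom of the ladder in one statement: `dim MT(H¹(X)) ≤ 3` iff CM of reduced dimension `≤ 2` -/

section Ladder

variable [HodgeTensorFacts.{0, 0}] {X : AbelianVariety ℂ} {n : ℕ}

/-- **`dim MT(H¹(X)) ≤ 3` iff `X` is isogenous to a product of copies of simple, pairwise non-isogenous CM abelian varieties
of total dimension `≤ 2`** (`0 < dim X`): the rungs `2` (`X ∼ E^g`, `E` CM elliptic — total dimension `1`) and `3`
(`X ∼ S^m` or `E₁^a × E₂^b` — total dimension `2`) of the Mumford–Tate rank ladder together.  `⟹`: `X` is of CM type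
(`isOfCMType_of_mtRank_hodge_one_le_three`), decompose (`exists_rdim_of_isOfCMType`) and apply Ribet's bound
`4 · Σ_c dim A'_c ≤ 2^{dim MT} ≤ 8`; `⟸`: `dim MT ≤ Σ_c dim A'_c + 1 ≤ 3`. [cite: Gordon1999HodgeAVSurvey, 7.4–7.7]
[cite: Dodson1987, Thm. 1.0 (iii)] [cite: MoonenZarhin1999LowDim, §2] -/
theorem mtRank_hodge_one_le_three_iff (hX : IsSmoothProjective n X.X) (h0 : 0 < X.dim) :
    haveI := BettiUniverse.finite hX 1
    (BettiUniverse.hodge exists_isReal_hodgeModel_holds hX 1).mtRank ≤ 3 ↔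
      ∃ (C : Type) (_ : Fintype C) (K' : C → Type) (_ : ∀ c, Field (K' c)) (_ : ∀ c, NumberField (K' c))
        (_ : ∀ c, IsCMField (K' c)) (Φ' : ∀ c, CMType (K' c)) (A' : C → AbelianVariety ℂ)
        (ι' : ∀ c, 𝓞 (K' c) →+* End (A' c)) (θ' : ∀ c, K' c →+* Module.End ℂ (complexBetti (A' c).X 1))
        (m : ℕ) (cls : Fin (m + 1) → C) (f : X ⟶ ⨁ fun i => A' (cls i)),
        (∀ c, IsCMTypeRealisation (Φ' c) (A' c) (ι' c) (θ' c)) ∧ (∀ c, (A' c).IsSimple) ∧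
        (∀ c c', c ≠ c' → ¬ IsIsogenous (A' c) (A' c')) ∧ Function.Surjective cls ∧ IsIsogeny f ∧
        ∑ c, (A' c).dim ≤ 2 := by
  haveI := BettiUniverse.finite hX 1
  constructor
  · intro h3
    obtain ⟨r, -, -, -, C, hC, K', hK₁, hK₂, hK₃, Φ', A', ι', θ', m, cls, f, hA, hs, hniso, hcls, hf, hrsum, -⟩ :=
      exists_rdim_of_isOfCMType hX h0 (isOfCMType_of_mtRank_hodge_one_le_three hX h3)
    have hrib := four_mul_sum_dim_le_two_pow_mtRank_hodge_one hA hs hniso hcls hX ⟨f, hf⟩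
    have hpow : 2 ^ (BettiUniverse.hodge exists_isReal_hodgeModel_holds hX 1).mtRank ≤ 2 ^ 3 :=
      Nat.pow_le_pow_right (by norm_num) h3
    exact ⟨C, hC, K', hK₁, hK₂, hK₃, Φ', A', ι', θ', m, cls, f, hA, hs, hniso, hcls, hf, by omega⟩
  · rintro ⟨C, _, K', _, _, _, Φ', A', ι', θ', m, cls, f, hA, hs, hniso, hcls, hf, hsum⟩
    haveI : Nonempty C := ⟨cls 0⟩
    have hle := mtRank_hodge_one_le_sum_dim_add_one_of_isIsogenous_biproduct hA hcls hX ⟨f, hf⟩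
    omega

end Ladder

end Summit.HodgeConjecture.CorCM

end
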